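import Summits.CriticalPhenomena.PercolationContinuityZ3.Theorems.Transplant.TwoAxisBand
import HarnessLib

/-!
# D″ node, LEVEL 0 supplement (DPRIME-SCOPE addendum N, repair R1 "strides ∝ r"): the two-unit parameter lemma with a GENERAL EXTENT FACTOR
# `L` — `TwoAxis.exists_twoUnitL`: for a monotone band with seed scale `m ≥ 2L + 1`, every `c ≥ 1`, `L ≥ 1`, `A ≥ 2·L·c` and every floor `n₀` there
# are `e_x, e_y ≥ max n₀ m` with `c·G(L·e_x) ≤ A·e_y` and `c·F⁻¹(L·e_y) ≤ A·e_x` (p4/p5's `exists_twoUnit` is the case `L = 3`, `A ≥ 6c`, `m ≥ 7`)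

builds on p205010 (kernel theorem, internal audit signed; external expert review pending) — nothing in this file uses p205010.
Lane `prim-bschramm`, seat `prim-bschramm-p3` (gen 7; D″ design owner); helper file (`--supports stmt-CriticalPhenomena-4575`).
WHY (F-DP4-1, p5-g6; lead 05:51:21Z): with unit strides `e` the corridor chains of the two-unit scheme have `≈ 19A` steps, `A ≥ K/5`, and the
one corridor-chain accuracy serves only `n ≤ nmaxC = 1000` steps — a cycle `δ → δ₂ → K₀ → K → A → n_C → δ`.  With strides `L·e`, `L ≈ A/17`,
the step count is `≤ 28A/L + O(1) ≤ 1000` for every `A`; the price is this lemma at factor `L` (its proof is the factor-3 proof verbatim: the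
case `e_y = q` needs `L·q < G(L e_x)`, which is where `A ≥ 2Lc` and `m > 2L` enter).
[cite: KozmaNitzan2024, §4 Lemma 11 pp. 22–23, Theorem 6 Step III p. 30] [cite: GrimmettPercolation1999, §7.3 Lemma (7.52) p. 170]
-/

noncomputable section

namespace Summit.CriticalPhenomena.PercolationContinuityZ3.Theorems.Transplant

namespace TwoAxis

open MeasureTheory Literature.Probability.Percolation SimpleGraph
open scoped Classical

variable {f g : ℕ → ℕ → ℝ} {τ : ℝ} {m : ℕ}

/-- **THE TWO-UNIT PARAMETER LEMMA WITH EXTENT FACTOR `L`.**  For every monotone band with `m ≥ 2L + 1`, every separation ratio `c ≥ 1`,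
stride factor `L ≥ 1`, unit ratio `A ≥ 2·L·c` and floor `n₀` there are step extents `e_x, e_y ≥ max(n₀, m)` with `c · G(L e_x) ≤ A · e_y`
and `c · F⁻¹(L e_y) ≤ A · e_x`. [cite: KozmaNitzan2024, §4 Lemma 11 pp. 22–23, Theorem 6 Step III p. 30] -/
theorem exists_twoUnitL (hb : IsMonotoneBand f g τ m) {L : ℕ} (hL : 1 ≤ L) (hm : 2 * L + 1 ≤ m) {c A : ℕ} (hc : 1 ≤ c)
    (hA : 2 * L * c ≤ A) (n₀ : ℕ) :
    ∃ ex ey : ℕ, n₀ ≤ ex ∧ n₀ ≤ ey ∧ m ≤ ex ∧ m ≤ ey ∧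
      c * bandG g τ m (L * ex) ≤ A * ey ∧ c * bandFinv f τ m (L * ey) ≤ A * ex := by
  have hA0 : 0 < A := by
    have : 1 ≤ 2 * L * c := by nlinarith
    omega
  -- the floor `E` and a width `ℓ⋆` certifying the tops at height `L·E` (input `f_unb`)
  set E : ℕ := max n₀ m with hE
  have hEm : m ≤ E := le_max_right _ _
  have hEn : n₀ ≤ E := le_max_left _ _
  have hLE : m ≤ L * E := hEm.trans (Nat.le_mul_of_pos_left E (by omega))
  obtain ⟨hℓm, hℓf⟩ := bandFinv_spec hb hLE
  set ℓs : ℕ := bandFinv f τ m (L * E) with hℓs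
  -- the x-step extent
  set ex : ℕ := max E ℓs with hex
  have hexE : E ≤ ex := le_max_left _ _
  have hexℓ : ℓs ≤ ex := le_max_right _ _
  have hexm : m ≤ ex := hEm.trans hexE
  have hLex : ex ≤ L * ex := Nat.le_mul_of_pos_left ex (by omega)
  have hmLex : m ≤ L * ex := hexm.trans hLex
  -- the spread of the longest x-step and the y-step extent
  set Gx : ℕ := bandG g τ m (L * ex) with hGx
  have hGxm : m ≤ Gx := (bandG_spec hb hmLex).1
  set q : ℕ := c * Gx / A + 1 with hq
  set ey : ℕ := max E q with hey
  have heyE : E ≤ ey := le_max_left _ _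
  have heyq : q ≤ ey := le_max_right _ _
  refine ⟨ex, ey, hEn.trans hexE, hEn.trans heyE, hexm, hEm.trans heyE, ?_, ?_⟩
  · -- `c · G(L e_x) ≤ A · e_y`
    rw [← hGx]
    have h1 : c * Gx < A * q := lt_mul_div_add_one hA0 (c * Gx)
    have h2 : A * q ≤ A * ey := Nat.mul_le_mul_left A heyq
    omega
  · -- `c · F⁻¹(L e_y) ≤ A · e_x`: the tops of `R(L e_x, L e_y)` are certified
    have hcert : τ ≤ f (L * ex) (L * ey) := by
      rcases le_total q E with hqe | hqe
      · -- `ey = E`: certified at width `ℓ⋆ ≤ e_x ≤ L e_x`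
        have heq : ey = E := by rw [hey, max_eq_left hqe]
        rw [heq]
        exact hℓf.trans (hb.f_mono_left (hexℓ.trans hLex))
      · -- `ey = q`: `L q < G(L e_x)`, so the dichotomy certifies the tops
        have heq : ey = q := by rw [hey, max_eq_right hqe]
        have hqm' : m ≤ q := hEm.trans hqe
        have hqm : m ≤ L * q := hqm'.trans (Nat.le_mul_of_pos_left q (by omega))
        -- `c·Gx/A ≤ Gx/(2L)` from `A ≥ 2Lc`
        set D : ℕ := Gx / (2 * L) with hD
        have hdiv : c * Gx / A ≤ D := by
          have h2 : 0 < 2 * L * c := by nlinarith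
          calc c * Gx / A ≤ c * Gx / (2 * L * c) := Nat.div_le_div_left hA h2
            _ = c * Gx / (c * (2 * L)) := by rw [Nat.mul_comm (2 * L) c]
            _ = Gx / (2 * L) := Nat.mul_div_mul_left Gx (2 * L) (by omega)
        have hDle : D * (2 * L) ≤ Gx := Nat.div_mul_le_self Gx (2 * L)
        have hqD : q ≤ D + 1 := by rw [hq]; omega
        have hP : L * q ≤ L * (D + 1) := Nat.mul_le_mul_left L hqD
        have hlt : L * q < Gx := by nlinarith
        rw [heq]
        exact f_cert_of_lt_bandG hb hmLex hqm hlt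
    have hle : bandFinv f τ m (L * ey) ≤ L * ex := bandFinv_le hmLex hcert
    calc c * bandFinv f τ m (L * ey) ≤ c * (L * ex) := Nat.mul_le_mul_left c hle
      _ = (L * c) * ex := by ring
      _ ≤ A * ex := Nat.mul_le_mul_right ex (by nlinarith)

end TwoAxis

end Summit.CriticalPhenomena.PercolationContinuityZ3.Theorems.Transplant

end
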